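import Mathlib
import HarnessLib

/-!
# Grid interpolation: coefficient extraction from values on `{0,…,n}^w`
(crux `OrbitRestorationQP`, stmt-ValiantsHypothesis-18293 — lane SML: the column-set-multilinear `ΣΠΣ` stratum of A_∞)

F6b of the blueprint `SML-STRATUM-BLUEPRINT.md`: the linear algebra that turns a narrow power-sum expansion into an
equivariant `ΣΠΣ` formula needs only this def-free fact.  For a module-valued "polynomial"
`Q τ = Σ_{κ : Fin w → Fin (n+1)} (Π_i (τ i)^{κ i}) • V κ` of degree `≤ n` in each of `w` variables, every coefficient
`V κ` is a `ℂ`-combination of the grid values `Q τ`, `τ ∈ {0,…,n}^w`: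

* `exists_interp_weights` — 1-D: weights `c k i` with `Σ_i c k i · i^{k'} = [k = k']` (`k, k' ≤ n`), read off from the
  coefficients of the Lagrange basis polynomials on the nodes `0,…,n`;
* `exists_grid_weights` — w-D product weights;
* `coeff_mem_span_gridValues` — `V κ ∈ span {Q τ}`.
[folklore]
-/

set_option linter.dupNamespace false

namespace Summit.ValiantsHypothesis.ValiantsHypothesis.Theorems.SmlInterpolation

open Finset Polynomial

/-- **1-D interpolation weights** on the nodes `0, 1, …, n`. [folklore] -/
theorem exists_interp_weights (n : ℕ) :
    ∃ c : Fin (n + 1) → Fin (n + 1) → ℂ, ∀ k k' : Fin (n + 1),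
      ∑ i : Fin (n + 1), c k i * ((i : ℕ) : ℂ) ^ (k' : ℕ) = if k = k' then 1 else 0 := by
  classical
  -- nodes `v i = i`, injective
  have hvs : Set.InjOn (fun i : Fin (n + 1) => ((i : ℕ) : ℂ)) (Finset.univ : Finset (Fin (n + 1))) := by
    intro i _ i' _ h
    simp only at h
    exact Fin.ext (by exact_mod_cast h)
  refine ⟨fun k i => (Lagrange.basis (Finset.univ : Finset (Fin (n + 1))) (fun i : Fin (n + 1) => ((i : ℕ) : ℂ)) i).coeff k,
    fun k k' => ?_⟩
  -- interpolate the monomial `X ^ k'`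
  have hdeg : (X ^ (k' : ℕ) : ℂ[X]).degree < #(Finset.univ : Finset (Fin (n + 1))) := by
    rw [Polynomial.degree_X_pow, Finset.card_univ, Fintype.card_fin]
    exact_mod_cast k'.isLt
  have hinterp := Lagrange.eq_interpolate (f := (X ^ (k' : ℕ) : ℂ[X])) hvs hdeg
  have hcoeff := congrArg (fun f : ℂ[X] => f.coeff k) hinterp
  simp only [Lagrange.interpolate_apply, Polynomial.eval_pow, Polynomial.eval_X, Polynomial.finsetSum_coeff,
    Polynomial.coeff_C_mul, Polynomial.coeff_X_pow] at hcoeff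
  rw [show (if (k : ℕ) = (k' : ℕ) then (1 : ℂ) else 0) = if k = k' then 1 else 0 by
    simp only [Fin.ext_iff]] at hcoeff
  rw [hcoeff]
  exact Finset.sum_congr rfl fun i _ => mul_comm _ _

/-- **Grid interpolation weights** on `{0,…,n}^w`. [folklore] -/
theorem exists_grid_weights (n w : ℕ) :
    ∃ c : (Fin w → Fin (n + 1)) → (Fin w → Fin (n + 1)) → ℂ, ∀ κ κ' : Fin w → Fin (n + 1),
      ∑ τ : Fin w → Fin (n + 1), c κ τ * ∏ i, ((τ i : ℕ) : ℂ) ^ (κ' i : ℕ) = if κ = κ' then 1 else 0 := by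
  classical
  obtain ⟨c₁, hc₁⟩ := exists_interp_weights n
  refine ⟨fun κ τ => ∏ i, c₁ (κ i) (τ i), fun κ κ' => ?_⟩
  calc ∑ τ : Fin w → Fin (n + 1), (∏ i, c₁ (κ i) (τ i)) * ∏ i, ((τ i : ℕ) : ℂ) ^ (κ' i : ℕ)
      = ∑ τ : Fin w → Fin (n + 1), ∏ i, (c₁ (κ i) (τ i) * ((τ i : ℕ) : ℂ) ^ (κ' i : ℕ)) := by
        refine Finset.sum_congr rfl fun τ _ => ?_
        rw [Finset.prod_mul_distrib]
    _ = ∏ i, ∑ r : Fin (n + 1), c₁ (κ i) r * ((r : ℕ) : ℂ) ^ (κ' i : ℕ) :=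
        (Fintype.prod_sum (fun i r => c₁ (κ i) r * ((r : ℕ) : ℂ) ^ (κ' i : ℕ))).symm
    _ = ∏ i, (if κ i = κ' i then (1 : ℂ) else 0) := Finset.prod_congr rfl fun i _ => hc₁ _ _
    _ = if κ = κ' then 1 else 0 := by
        by_cases h : κ = κ'
        · subst h; simp
        · rw [if_neg h]
          obtain ⟨i, hi⟩ : ∃ i, κ i ≠ κ' i := by
            by_contra hcon; simp only [not_exists, not_not] at hcon; exact h (funext hcon)
          exact Finset.prod_eq_zero (Finset.mem_univ i) (if_neg hi)

/-- **Coefficient extraction from grid values.**  If `Q τ = Σ_κ (Π_i (τ i)^{κ i}) • V κ` for all grid points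
`τ ∈ {0,…,n}^w`, then every `V κ` lies in the span of the `Q τ`. [folklore] -/
theorem coeff_mem_span_gridValues {M : Type*} [AddCommGroup M] [Module ℂ M] (n w : ℕ)
    (V Q : (Fin w → Fin (n + 1)) → M)
    (hQ : ∀ τ, Q τ = ∑ κ : Fin w → Fin (n + 1), (∏ i, ((τ i : ℕ) : ℂ) ^ (κ i : ℕ)) • V κ)
    (κ : Fin w → Fin (n + 1)) :
    V κ ∈ Submodule.span ℂ (Set.range Q) := by
  classical
  obtain ⟨c, hc⟩ := exists_grid_weights n w
  have hV : V κ = ∑ τ : Fin w → Fin (n + 1), c κ τ • Q τ := by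
    simp_rw [hQ, Finset.smul_sum, smul_smul]
    rw [Finset.sum_comm]
    simp_rw [← Finset.sum_smul, hc]
    rw [Finset.sum_eq_single κ]
    · simp
    · intro κ' _ hne; rw [if_neg (Ne.symm hne), zero_smul]
    · intro h; exact absurd (Finset.mem_univ κ) h
  rw [hV]
  exact Submodule.sum_mem _ fun τ _ => Submodule.smul_mem _ _ (Submodule.subset_span ⟨τ, rfl⟩)

end Summit.ValiantsHypothesis.ValiantsHypothesis.Theorems.SmlInterpolation
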